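import Literature.Analysis.FluidPDE.HouTwoScaleRescaling
import HarnessLib

/-!
# The two-parameter symmetry group of Hou's steady one-scale profile system and its gauge invariants

Topic `Literature/Analysis/FluidPDE`. Theorems only, about the tree's predicate
`HouSelfSimilarProfile n ν₀ cl cu U Ω Ψ` (`HouTwoScaleRescaling.lean`: the steady one-scale self-similar
profile system of Hou, arXiv:2405.10916 §3, unknowns `(ũ₁, ω̃₁, ψ̃₁) = (U, Ω, Ψ)`, gauge exponents
`(c_l, c_u)`, rescaled viscosity `ν₀`).

## What is proved

After the symmetry pinning (axisymmetry, oddness in `η`) the steady system still has a two-parameter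
group of exact symmetries — the reason a numerical profile needs TWO normalisations and the reason only
gauge-invariant combinations of `(ν₀, c_l, c_u)` can be compared between codes:

* `HouSelfSimilarProfile.smul` — **time unit** `μ`: `(U, Ω, Ψ, c_l, c_u, ν₀) ↦ (μU, μΩ, μΨ, μc_l, μc_u, μν₀)`
  maps profiles to profiles (every term of the `ũ₁`- and `ω̃₁`-equations is bilinear in
  {fields} × {fields, `c`, `ν₀`}; the `ψ̃₁`-equation is linear).
* `HouSelfSimilarProfile.dilate` — **dilation** `λ > 0`:
  `(U, Ω, Ψ)(Y) ↦ (U(λY), λ Ω(λY), λ⁻¹ Ψ(λY))`, `ν₀ ↦ ν₀/λ²`, `(c_l, c_u)` unchanged.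
* Gauge invariants (`collapseExponent_smul`, `nu0_gauge_smul`, `nu0_gauge_dilate`,
  `exponent_gauge_smul`): `ĉ_l = c_l/(−c_u)` is invariant under both; for any reference point `q`
  (in practice the maximiser of `ũ₁`, value `M`, height `η_m`) the combinations `ν₀/(U(q)·η²)` and
  `c/U(q)` take the same value at corresponding points — the "Hou gauge" `ν₀^H = ν₀/(M η_m²)`,
  `c^H = c/M` in which `‖ũ₁‖_∞ = 1` is attained at `η = 1` (arXiv:2405.10916 §3: the dynamic rescaling
  normalises the maximum of `u₁` and its location).

## Use

Kernel backing of the `ns-blowup` zone-Z5 (S) instrument's bookkeeping (ENGINE-B.md §1.3/§2.4, reading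
rule (dd)): engine B continues steady roots in its own windowed normalisation `(N_A, N_S)`; RESULT lines
and twin comparisons with engine A are stated in the invariants `ν₀^H`, `c^H`, `ĉ_l`, which this file
shows are well defined on orbits of the symmetry group.

## WHAT THIS IS NOT

Nothing about Navier–Stokes and no existence statement: exact symmetries of a MODEL profile system.

Search: tree `HouSelfSimilarProfile` (+ `.neg`, p506281), `derivR/derivZ`, `GeneralizedAxisymNS.lap/
radialVel/axialVel`; Mathlib `fderiv_const_mul`, `HasFDerivAt.const_smul`, `HasFDerivAt.comp`,
`ContDiff.comp`, `contDiff_const_smul`. No symmetry lemma for the predicate existed.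
-/

noncomputable section

open Set
open scoped ContDiff

namespace Literature.Analysis.FluidPDE

/-! ### Calculus of `derivR`/`derivZ` under scaling of the value and of the argument (private) -/

variable {G : ℝ × ℝ → ℝ}

/-- `∂ᵣ(cG) = c ∂ᵣG` for differentiable `G`. [folklore] -/
private theorem derivR_const_mul (hG : Differentiable ℝ G) (c : ℝ) (q : ℝ × ℝ) :
    derivR (fun p => c * G p) q = c * derivR G q := by
  simp [derivR_apply, fderiv_const_mul (hG q)]

/-- `∂_z(cG) = c ∂_zG` for differentiable `G`. [folklore] -/
private theorem derivZ_const_mul (hG : Differentiable ℝ G) (c : ℝ) (q : ℝ × ℝ) :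
    derivZ (fun p => c * G p) q = c * derivZ G q := by
  simp [derivZ_apply, fderiv_const_mul (hG q)]

/-- Chain rule for the dilation `p ↦ λ • p`: `D(G(λ·))(q) v = λ DG(λq) v`. [folklore] -/
private theorem fderiv_comp_smul_apply (hG : Differentiable ℝ G) (lam : ℝ) (q v : ℝ × ℝ) :
    fderiv ℝ (fun p => G (lam • p)) q v = lam * fderiv ℝ G (lam • q) v := by
  have h1 : HasFDerivAt (fun p : ℝ × ℝ => lam • p) (lam • ContinuousLinearMap.id ℝ (ℝ × ℝ)) q :=
    (hasFDerivAt_id q).const_smul lam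
  have h2 : HasFDerivAt (fun p => G (lam • p)) ((fderiv ℝ G (lam • q)).comp
      (lam • ContinuousLinearMap.id ℝ (ℝ × ℝ))) q := (hG (lam • q)).hasFDerivAt.comp q h1
  rw [h2.fderiv]
  simp [smul_eq_mul]

/-- `∂ᵣ(G(λ·))(q) = λ (∂ᵣG)(λq)`. [folklore] -/
private theorem derivR_comp_smul (hG : Differentiable ℝ G) (lam : ℝ) (q : ℝ × ℝ) :
    derivR (fun p => G (lam • p)) q = lam * derivR G (lam • q) := by
  rw [derivR_apply, derivR_apply, fderiv_comp_smul_apply hG]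

/-- `∂_z(G(λ·))(q) = λ (∂_zG)(λq)`. [folklore] -/
private theorem derivZ_comp_smul (hG : Differentiable ℝ G) (lam : ℝ) (q : ℝ × ℝ) :
    derivZ (fun p => G (lam • p)) q = lam * derivZ G (lam • q) := by
  rw [derivZ_apply, derivZ_apply, fderiv_comp_smul_apply hG]

/-- `∂ᵣ∂ᵣ(G(λ·))(q) = λ² (∂ᵣ∂ᵣG)(λq)` for smooth `G`. [folklore] -/
private theorem derivR_derivR_comp_smul (hG : ContDiff ℝ ∞ G) (lam : ℝ) (q : ℝ × ℝ) :
    derivR (derivR fun p => G (lam • p)) q = lam ^ 2 * derivR (derivR G) (lam • q) := by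
  have hd : Differentiable ℝ G := hG.differentiable (by simp)
  have hdd : Differentiable ℝ (derivR G) := (contDiff_derivR hG).differentiable (by simp)
  have e : derivR (fun p => G (lam • p)) = fun p => lam * derivR G (lam • p) :=
    funext fun p => derivR_comp_smul hd lam p
  have hc : Differentiable ℝ (fun p : ℝ × ℝ => derivR G (lam • p)) :=
    hdd.comp (differentiable_id.const_smul lam)
  rw [e, derivR_const_mul hc lam, derivR_comp_smul hdd]
  ring

/-- `∂_z∂_z(G(λ·))(q) = λ² (∂_z∂_zG)(λq)` for smooth `G`. [folklore] -/
private theorem derivZ_derivZ_comp_smul (hG : ContDiff ℝ ∞ G) (lam : ℝ) (q : ℝ × ℝ) :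
    derivZ (derivZ fun p => G (lam • p)) q = lam ^ 2 * derivZ (derivZ G) (lam • q) := by
  have hd : Differentiable ℝ G := hG.differentiable (by simp)
  have hdd : Differentiable ℝ (derivZ G) := (contDiff_derivZ hG).differentiable (by simp)
  have e : derivZ (fun p => G (lam • p)) = fun p => lam * derivZ G (lam • p) :=
    funext fun p => derivZ_comp_smul hd lam p
  have hc : Differentiable ℝ (fun p : ℝ × ℝ => derivZ G (lam • p)) :=
    hdd.comp (differentiable_id.const_smul lam)
  rw [e, derivZ_const_mul hc lam, derivZ_comp_smul hdd]
  ring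

/-- `∂ᵣ∂ᵣ(cG) = c ∂ᵣ∂ᵣG` for smooth `G`. [folklore] -/
private theorem derivR_derivR_const_mul (hG : ContDiff ℝ ∞ G) (c : ℝ) (q : ℝ × ℝ) :
    derivR (derivR fun p => c * G p) q = c * derivR (derivR G) q := by
  have hd : Differentiable ℝ G := hG.differentiable (by simp)
  have hdd : Differentiable ℝ (derivR G) := (contDiff_derivR hG).differentiable (by simp)
  have e : derivR (fun p => c * G p) = fun p => c * derivR G p := funext fun p => derivR_const_mul hd c p
  rw [e, derivR_const_mul hdd]

/-- `∂_z∂_z(cG) = c ∂_z∂_zG` for smooth `G`. [folklore] -/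
private theorem derivZ_derivZ_const_mul (hG : ContDiff ℝ ∞ G) (c : ℝ) (q : ℝ × ℝ) :
    derivZ (derivZ fun p => c * G p) q = c * derivZ (derivZ G) q := by
  have hd : Differentiable ℝ G := hG.differentiable (by simp)
  have hdd : Differentiable ℝ (derivZ G) := (contDiff_derivZ hG).differentiable (by simp)
  have e : derivZ (fun p => c * G p) = fun p => c * derivZ G p := funext fun p => derivZ_const_mul hd c p
  rw [e, derivZ_const_mul hdd]

/-- `L_n(cG) = c L_nG` for smooth `G`. [folklore] -/
private theorem lap_const_mul (hG : ContDiff ℝ ∞ G) (n c : ℝ) (q : ℝ × ℝ) :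
    GeneralizedAxisymNS.lap n (fun p => c * G p) q = c * GeneralizedAxisymNS.lap n G q := by
  simp only [GeneralizedAxisymNS.lap, derivR_derivR_const_mul hG, derivZ_derivZ_const_mul hG,
    derivR_const_mul (hG.differentiable (by simp))]
  ring

/-- `L_n(G(λ·))(q) = λ² (L_nG)(λq)` for smooth `G`, `λ ≠ 0` (`(λq).1 = λ q.1`). [folklore] -/
private theorem lap_comp_smul (hG : ContDiff ℝ ∞ G) (n : ℝ) {lam : ℝ} (hlam : lam ≠ 0)
    (q : ℝ × ℝ) :
    GeneralizedAxisymNS.lap n (fun p => G (lam • p)) q =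
      lam ^ 2 * GeneralizedAxisymNS.lap n G (lam • q) := by
  simp only [GeneralizedAxisymNS.lap, derivR_derivR_comp_smul hG, derivZ_derivZ_comp_smul hG,
    derivR_comp_smul (hG.differentiable (by simp)), Prod.smul_fst, smul_eq_mul]
  by_cases hq : q.1 = 0
  · simp only [hq, mul_zero, div_zero, zero_mul, add_zero]
    ring
  · field_simp

namespace HouSelfSimilarProfile

variable {n ν₀ cl cu : ℝ} {U Ω Ψ : ℝ × ℝ → ℝ}

/-! ### Time-unit symmetry -/

/-- **Time-unit symmetry.** If `(U, Ω, Ψ)` is a profile with exponents `(c_l, c_u)` and rescaled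
viscosity `ν₀`, then `(μU, μΩ, μΨ)` is a profile with `(μc_l, μc_u)` and `μν₀`, for every real `μ`:
all terms of the `ũ₁`- and `ω̃₁`-equations of arXiv:2405.10916 §3 are bilinear in the fields and in
(fields, `c`, `ν₀`), and `−L_nψ̃₁ = ω̃₁` is linear — the choice of the blow-up time unit.
[cite: Hou2026, §3 (self-similar equations of the steady state)] -/
theorem smul (hP : HouSelfSimilarProfile n ν₀ cl cu U Ω Ψ) (μ : ℝ) :
    HouSelfSimilarProfile n (μ * ν₀) (μ * cl) (μ * cu) (fun p => μ * U p) (fun p => μ * Ω p)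
      (fun p => μ * Ψ p) := by
  have hU := hP.smooth_U; have hΩ := hP.smooth_Ω; have hΨ := hP.smooth_Ψ
  have hUd : Differentiable ℝ U := hU.differentiable (by simp)
  have hΩd : Differentiable ℝ Ω := hΩ.differentiable (by simp)
  have hΨd : Differentiable ℝ Ψ := hΨ.differentiable (by simp)
  have hU2d : Differentiable ℝ (fun p => U p ^ 2) := hUd.pow 2
  refine ⟨contDiff_const.mul hU, contDiff_const.mul hΩ, contDiff_const.mul hΨ,
    fun ξ η => by simp [hP.even_U ξ η], fun ξ η => by simp [hP.even_Ω ξ η],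
    fun ξ η => by simp [hP.even_Ψ ξ η], ?_, ?_, ?_⟩
  · intro q hq
    have h := hP.swirl_eq q hq
    simp only [GeneralizedAxisymNS.radialVel, GeneralizedAxisymNS.axialVel] at h ⊢
    rw [derivR_const_mul hUd, derivZ_const_mul hUd, derivR_const_mul hΨd, derivZ_const_mul hΨd,
      lap_const_mul hU]
    linear_combination (μ ^ 2) * h
  · intro q hq
    have h := hP.vorticity_eq q hq
    simp only [GeneralizedAxisymNS.radialVel, GeneralizedAxisymNS.axialVel] at h ⊢
    have hsq : (fun q' : ℝ × ℝ => (μ * U q') ^ 2) = fun q' => μ ^ 2 * (U q' ^ 2) := by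
      funext q'; ring
    rw [hsq, derivR_const_mul hΩd, derivZ_const_mul hΩd, derivR_const_mul hΨd, derivZ_const_mul hΨd,
      derivZ_const_mul hU2d, lap_const_mul hΩ]
    linear_combination (μ ^ 2) * h
  · intro q hq
    have h := hP.stream_eq q hq
    rw [lap_const_mul hΨ]
    linear_combination μ * h

/-! ### Dilation symmetry -/

/-- **Dilation symmetry.** If `(U, Ω, Ψ)` is a profile with `(c_l, c_u, ν₀)`, then for every `λ > 0`
`(U(λY), λ Ω(λY), λ⁻¹ Ψ(λY))` is a profile with the SAME `(c_l, c_u)` and rescaled viscosity `ν₀/λ²`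
(the transport `c_l Y·∇` is scale invariant, the velocity `ũ` of `λ⁻¹ψ̃₁(λY)` is `λ⁻¹ũ(λY)`, and the
vorticity source `(ũ₁²)_η` fixes the amplitude of `ũ₁`) — the choice of the length unit of the
similarity variables (arXiv:2405.10916 §3, where it is fixed by the location of `max u₁`).
[cite: Hou2026, §3 (self-similar equations of the steady state)] -/
theorem dilate (hP : HouSelfSimilarProfile n ν₀ cl cu U Ω Ψ) {lam : ℝ} (hlam : 0 < lam) :
    HouSelfSimilarProfile n (ν₀ / lam ^ 2) cl cu (fun p => U (lam • p)) (fun p => lam * Ω (lam • p))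
      (fun p => lam⁻¹ * Ψ (lam • p)) := by
  have hl : lam ≠ 0 := hlam.ne'
  have hU := hP.smooth_U; have hΩ := hP.smooth_Ω; have hΨ := hP.smooth_Ψ
  have hUd : Differentiable ℝ U := hU.differentiable (by simp)
  have hΩd : Differentiable ℝ Ω := hΩ.differentiable (by simp)
  have hΨd : Differentiable ℝ Ψ := hΨ.differentiable (by simp)
  have hsm : ContDiff ℝ ∞ (fun p : ℝ × ℝ => lam • p) := contDiff_id.const_smul lam
  have hUl : ContDiff ℝ ∞ (fun p => U (lam • p)) := hU.comp hsm
  have hΩl : ContDiff ℝ ∞ (fun p => Ω (lam • p)) := hΩ.comp hsm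
  have hΨl : ContDiff ℝ ∞ (fun p => Ψ (lam • p)) := hΨ.comp hsm
  have hΩld : Differentiable ℝ (fun p => Ω (lam • p)) := hΩl.differentiable (by simp)
  have hΨld : Differentiable ℝ (fun p => Ψ (lam • p)) := hΨl.differentiable (by simp)
  have hU2d : Differentiable ℝ (fun p => U p ^ 2) := hUd.pow 2
  have hev : ∀ ξ η : ℝ, lam • ((-ξ, η) : ℝ × ℝ) = (-(lam * ξ), lam * η) := fun ξ η => by
    simp [Prod.smul_mk, smul_eq_mul]
  have hev' : ∀ ξ η : ℝ, lam • ((ξ, η) : ℝ × ℝ) = (lam * ξ, lam * η) := fun ξ η => by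
    simp [Prod.smul_mk, smul_eq_mul]
  refine ⟨hUl, contDiff_const.mul hΩl, contDiff_const.mul hΨl,
    fun ξ η => by rw [hev, hev', hP.even_U], fun ξ η => by rw [hev, hev', hP.even_Ω],
    fun ξ η => by rw [hev, hev', hP.even_Ψ], ?_, ?_, ?_⟩
  · intro q hq
    have hQ : 0 < (lam • q).1 := by rw [Prod.smul_fst, smul_eq_mul]; positivity
    have h := hP.swirl_eq (lam • q) hQ
    simp only [GeneralizedAxisymNS.radialVel, GeneralizedAxisymNS.axialVel, Prod.smul_fst,
      Prod.smul_snd, smul_eq_mul] at h ⊢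
    rw [derivR_comp_smul hUd, derivZ_comp_smul hUd, derivR_const_mul hΨld, derivZ_const_mul hΨld,
      derivR_comp_smul hΨd, derivZ_comp_smul hΨd, lap_comp_smul hU n hl]
    linear_combination (norm := skip) h
    field_simp
    ring
  · intro q hq
    have hQ : 0 < (lam • q).1 := by rw [Prod.smul_fst, smul_eq_mul]; positivity
    have h := hP.vorticity_eq (lam • q) hQ
    simp only [GeneralizedAxisymNS.radialVel, GeneralizedAxisymNS.axialVel, Prod.smul_fst,
      Prod.smul_snd, smul_eq_mul] at h ⊢
    have hsq : (fun q' : ℝ × ℝ => U (lam • q') ^ 2) = fun q' => (fun p => U p ^ 2) (lam • q') := rfl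
    rw [hsq, derivZ_comp_smul hU2d, derivR_const_mul hΩld, derivZ_const_mul hΩld,
      derivR_comp_smul hΩd, derivZ_comp_smul hΩd, derivR_const_mul hΨld, derivZ_const_mul hΨld,
      derivR_comp_smul hΨd, derivZ_comp_smul hΨd, lap_const_mul hΩl, lap_comp_smul hΩ n hl]
    linear_combination (norm := skip) lam * h
    field_simp
    ring
  · intro q hq
    have hQ : 0 < (lam • q).1 := by rw [Prod.smul_fst, smul_eq_mul]; positivity
    have h := hP.stream_eq (lam • q) hQ
    rw [lap_const_mul hΨl, lap_comp_smul hΨ n hl]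
    linear_combination (norm := skip) lam * h
    field_simp
    ring

/-! ### Gauge invariants -/

/-- The normalized length exponent `ĉ_l = c_l/(−c_u)` is invariant under the time-unit symmetry
(`μ ≠ 0`). [cite: Hou2026, §1.1 (ν = ν₀(T−t)^{2c_l−1})] -/
theorem collapseExponent_smul {cl cu μ : ℝ} (hμ : μ ≠ 0) :
    (μ * cl) / (-(μ * cu)) = cl / (-cu) := by
  rw [← mul_neg, mul_div_mul_left _ _ hμ]

/-- **The Hou-gauge viscosity is a time-unit invariant**: `(μν₀)/((μU)(q)·η²) = ν₀/(U(q)·η²)` at every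
point `q` (`μ ≠ 0`); with `q` the maximiser of `ũ₁` this is `ν₀^H = ν₀/(M η_m²)`.
[cite: Hou2026, §3 (self-similar equations of the steady state)] -/
theorem nu0_gauge_smul {μ : ℝ} (hμ : μ ≠ 0) (U : ℝ × ℝ → ℝ) (ν₀ : ℝ) (q : ℝ × ℝ) :
    (μ * ν₀) / ((μ * U q) * q.2 ^ 2) = ν₀ / (U q * q.2 ^ 2) := by
  rw [mul_assoc, mul_div_mul_left _ _ hμ]

/-- **The Hou-gauge exponents are time-unit invariants**: `(μc)/((μU)(q)) = c/U(q)` (`μ ≠ 0`); with `q`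
the maximiser of `ũ₁`, `c^H = c/M`. [cite: Hou2026, §3 (self-similar equations of the steady state)] -/
theorem exponent_gauge_smul {μ : ℝ} (hμ : μ ≠ 0) (U : ℝ × ℝ → ℝ) (c : ℝ) (q : ℝ × ℝ) :
    (μ * c) / (μ * U q) = c / U q :=
  mul_div_mul_left _ _ hμ

/-- **The Hou-gauge viscosity is a dilation invariant**: for the dilated profile `U'(Y) = U(λY)` with
`ν₀' = ν₀/λ²`, at corresponding points `q' = λ⁻¹q`: `ν₀'/(U'(q')·(q'.2)²) = ν₀/(U(q)·(q.2)²)` (`λ ≠ 0`).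
[cite: Hou2026, §3 (self-similar equations of the steady state)] -/
theorem nu0_gauge_dilate {lam : ℝ} (hlam : lam ≠ 0) (U : ℝ × ℝ → ℝ) (ν₀ : ℝ) (q : ℝ × ℝ) :
    (ν₀ / lam ^ 2) / ((fun p => U (lam • p)) (lam⁻¹ • q) * (lam⁻¹ • q).2 ^ 2) =
      ν₀ / (U q * q.2 ^ 2) := by
  have e : lam • lam⁻¹ • q = q := by rw [smul_smul, mul_inv_cancel₀ hlam, one_smul]
  simp only [e, Prod.smul_snd, smul_eq_mul]
  by_cases hU : U q = 0
  · simp [hU]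
  by_cases hq : q.2 = 0
  · simp [hq]
  field_simp

end HouSelfSimilarProfile

end Literature.Analysis.FluidPDE
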